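import Summits.AtomisticToContinuum.HydrodynamicLimit.Theorems.JParityClosureLocalSecondLawContactCondLaw
import Summits.AtomisticToContinuum.HydrodynamicLimit.Theorems.BoxDissipativeWeakStrongLocalGibbsFineScaleCgibbs

/-!
# Stub B′|ML (`stub_initialMatchingOfStatics`) of the line `contact-asymmetry-information` for the crux `LocalSecondLaw`
(stmt-AtomisticToContinuum-13081) — part 2: the modulus of the position entropy `∫ b_r n log n`

The position half of the HARD (upper) direction of the initial matching B′ compares the cone-smeared position entropy
`∫ b_r(y,x) n_S(y) log n_S(y) dy` of the one-body position density `n_S` of a bounded tilt with that of the limit density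
`ρ₀`.  Part 1 (`…InitialMatchingTV`) supplies `‖n_S − ρ₀‖_{L¹} ≤ κ` and `n_S ≤ K′` a.e.; this file turns these into the
entropy estimate, uniformly in the centre `x`:

* `em_mul_log_sub_mul_log_le`, `em_abs_mul_log_sub_mul_log_le` — the elementary modulus of `t ↦ t log t` on `[0, K′]`
  (`K′ ≥ 1`): `|t log t − s log s| ≤ (1 + log K′)|t − s| + 2 √|t − s|` (from `log x ≤ x − 1` twice: `s log(t/s) ≤ t − s` and
  `d log(1/d) ≤ 2√d`);
* `em_integral_sqrt_abs_le` — `∫ √|g| ≤ √(∫ |g|)` on the unit torus (Cauchy–Schwarz);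
* **`em_cone_entropy_sub_le`** — for measurable `0 ≤ n₁ ≤ K′` a.e., continuous `0 ≤ n₂ ≤ K′` with `∫ |n₁ − n₂| ≤ κ`:
  `|∫ b_r(y,x) (n₁ log n₁ − n₂ log n₂)(y) dy| ≤ (3/(π r³)) ((1 + log K′) κ + 2 √κ)` for every centre `x`.

References: I. Csiszár, J. Körner, *Information Theory* (2011), Lemma 2.7 (continuity of entropy in total variation,
`|H(P) − H(Q)| ≤ θ log(K/θ)`-type bounds); H. Spohn, *Large Scale Dynamics of Interacting Particles* (1991), Part I §2.3.
Lead c16 (prover-line-stmt-AtomisticToContinuum-13081-c16-0).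
-/

noncomputable section

open scoped BigOperators Topology Classical MeasureTheory ENNReal InnerProductSpace
open Filter Set MeasureTheory Function
open Literature.MathematicalPhysics.KineticTheory
open Literature.Analysis.FluidPDE
open Summit.AtomisticToContinuum.HydrodynamicLimit.Theorems.LocalSecondLawNegative
open Summit.AtomisticToContinuum.HydrodynamicLimit.Theorems.LocalSecondLawLedger
open Summit.AtomisticToContinuum.HydrodynamicLimit.Theorems.LocalSecondLawContact

namespace Summit.AtomisticToContinuum.HydrodynamicLimit.Theorems.LocalSecondLawInitialMatching

/-! ### The modulus of `t ↦ t log t` -/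

/-- `d · log(1/d) ≤ 2 √d` for `0 ≤ d`, i.e. `-(d log d) ≤ 2 √d` (`log(1/√d) ≤ 1/√d − 1`). -/
theorem em_neg_mul_log_le_two_sqrt {d : ℝ} (hd : 0 ≤ d) : -(d * Real.log d) ≤ 2 * Real.sqrt d := by
  rcases hd.eq_or_lt with h | h
  · rw [← h]; simp
  · have hs : 0 < Real.sqrt d := Real.sqrt_pos.2 h
    have h1 : Real.log (Real.sqrt d)⁻¹ ≤ (Real.sqrt d)⁻¹ - 1 := Real.log_le_sub_one_of_pos (inv_pos.2 hs)
    have h2 : Real.log d = 2 * Real.log (Real.sqrt d) := by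
      conv_lhs => rw [← Real.sq_sqrt h.le]
      rw [Real.log_pow]; norm_num
    rw [Real.log_inv] at h1
    have h3 : -(d * Real.log d) = 2 * d * (-Real.log (Real.sqrt d)) := by rw [h2]; ring
    rw [h3]
    have h4 : d * (Real.sqrt d)⁻¹ = Real.sqrt d := by
      rw [eq_comm, eq_mul_inv_iff_mul_eq₀ hs.ne', ← sq, Real.sq_sqrt h.le]
    calc 2 * d * (-Real.log (Real.sqrt d)) ≤ 2 * d * ((Real.sqrt d)⁻¹ - 1) :=
          mul_le_mul_of_nonneg_left h1 (by positivity)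
      _ = 2 * (d * (Real.sqrt d)⁻¹) - 2 * d := by ring
      _ ≤ 2 * Real.sqrt d := by rw [h4]; linarith

/-- One-sided modulus: for `0 ≤ s ≤ t ≤ K′`, `1 ≤ K′`:
`t log t − s log s ≤ (1 + log K′)(t − s)` and `−2√(t − s) ≤ t log t − s log s`. -/
theorem em_mul_log_sub_mul_log_le {s t K : ℝ} (hs : 0 ≤ s) (hst : s ≤ t) (htK : t ≤ K) (hK : 1 ≤ K) :
    t * Real.log t - s * Real.log s ≤ (1 + Real.log K) * (t - s) ∧
      -(2 * Real.sqrt (t - s)) ≤ t * Real.log t - s * Real.log s := by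
  have hlogK : 0 ≤ Real.log K := Real.log_nonneg hK
  rcases hs.eq_or_lt with h0 | h0
  · -- `s = 0`
    subst h0
    simp only [zero_mul, sub_zero, Real.log_zero]
    rcases (le_refl (0 : ℝ)).trans hst |>.eq_or_lt with ht0 | ht0
    · rw [← ht0]; simp
    · constructor
      · have h1 : Real.log t ≤ Real.log K := Real.log_le_log ht0 htK
        nlinarith
      · linarith [em_neg_mul_log_le_two_sqrt ht0.le]
  · have ht0 : 0 < t := h0.trans_le hst
    -- the identity `t log t − s log s = (t − s) log t + s log (t/s)`
    have hid : t * Real.log t - s * Real.log s = (t - s) * Real.log t + s * Real.log (t / s) := by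
      rw [Real.log_div ht0.ne' h0.ne']; ring
    have hq : 0 ≤ s * Real.log (t / s) ∧ s * Real.log (t / s) ≤ t - s := by
      have hts : 1 ≤ t / s := by rwa [le_div_iff₀ h0, one_mul]
      refine ⟨mul_nonneg hs (Real.log_nonneg hts), ?_⟩
      have h1 : Real.log (t / s) ≤ t / s - 1 := Real.log_le_sub_one_of_pos (by positivity)
      calc s * Real.log (t / s) ≤ s * (t / s - 1) := mul_le_mul_of_nonneg_left h1 hs
        _ = t - s := by field_simp
    constructor
    · rw [hid]
      have h1 : Real.log t ≤ Real.log K := Real.log_le_log ht0 htK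
      nlinarith [hq.2, sub_nonneg.2 hst]
    · rw [hid]
      -- `(t − s) log t ≥ −2√(t − s)`
      have hd : 0 ≤ t - s := sub_nonneg.2 hst
      have h2 : -(2 * Real.sqrt (t - s)) ≤ (t - s) * Real.log t := by
        by_cases ht1 : 1 ≤ t
        · have := Real.log_nonneg ht1
          have := Real.sqrt_nonneg (t - s)
          nlinarith
        · push Not at ht1
          -- `log t ≥ log (t − s)` and `(t − s) log (t − s) ≥ −2√(t − s)`
          rcases hd.eq_or_lt with hd0 | hd0
          · rw [← hd0]; simp
          · have h3 : Real.log (t - s) ≤ Real.log t := Real.log_le_log hd0 (by linarith)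
            have h4 := em_neg_mul_log_le_two_sqrt hd
            nlinarith
      linarith [hq.1]

/-- **The modulus of `t log t` on `[0, K′]`** (`K′ ≥ 1`): `|t log t − s log s| ≤ (1 + log K′)|t − s| + 2√|t − s|`. -/
theorem em_abs_mul_log_sub_mul_log_le {s t K : ℝ} (hs : 0 ≤ s) (ht : 0 ≤ t) (hsK : s ≤ K) (htK : t ≤ K)
    (hK : 1 ≤ K) :
    |t * Real.log t - s * Real.log s| ≤ (1 + Real.log K) * |t - s| + 2 * Real.sqrt |t - s| := by
  have hlogK : 0 ≤ Real.log K := Real.log_nonneg hK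
  rcases le_total s t with hst | hts
  · obtain ⟨h1, h2⟩ := em_mul_log_sub_mul_log_le hs hst htK hK
    rw [abs_of_nonneg (sub_nonneg.2 hst)]
    rw [abs_le]
    constructor
    · have := Real.sqrt_nonneg (t - s)
      nlinarith [sub_nonneg.2 hst]
    · have := Real.sqrt_nonneg (t - s)
      linarith
  · obtain ⟨h1, h2⟩ := em_mul_log_sub_mul_log_le ht hts hsK hK
    rw [abs_sub_comm (t * Real.log t), abs_sub_comm t s, abs_of_nonneg (sub_nonneg.2 hts), abs_le]
    constructor
    · have := Real.sqrt_nonneg (s - t)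
      nlinarith [sub_nonneg.2 hts]
    · have := Real.sqrt_nonneg (s - t)
      linarith

/-- `|t log t| ≤ K′ log K′ + 1` on `[0, K′]` (`K′ ≥ 1`). -/
theorem em_abs_mul_log_le {t K : ℝ} (ht : 0 ≤ t) (htK : t ≤ K) (hK : 1 ≤ K) :
    |t * Real.log t| ≤ K * Real.log K + 1 := by
  have hlogK : 0 ≤ Real.log K := Real.log_nonneg hK
  rw [abs_le]
  constructor
  · have h2 : -1 ≤ t * Real.log t := by
      rcases ht.eq_or_lt with h0 | h0
      · rw [← h0]; simp
      · exact mul_log_ge_neg_one h0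
    linarith [mul_nonneg (le_trans zero_le_one hK) hlogK]
  · rcases ht.eq_or_lt with h0 | h0
    · rw [← h0]; simp; positivity
    · have h1 : Real.log t ≤ Real.log K := Real.log_le_log h0 htK
      nlinarith

/-! ### Integral estimates on the unit torus -/

/-- **`∫ √|g| ≤ √(∫ |g|)` on the unit torus** (Cauchy–Schwarz on a probability space), for integrable `g`. -/
theorem em_integral_sqrt_abs_le {g : T3 → ℝ} (hg : Integrable g) :
    ∫ y, Real.sqrt |g y| ≤ Real.sqrt (∫ y, |g y|) := by
  have hm : AEStronglyMeasurable (fun y => Real.sqrt |g y|) volume :=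
    (Real.continuous_sqrt.comp_aestronglyMeasurable (hg.aestronglyMeasurable.norm.congr
      (ae_of_all _ fun y => Real.norm_eq_abs (g y))))
  have hsq : (fun y => Real.sqrt |g y| ^ 2) = fun y => |g y| := by
    funext y; exact Real.sq_sqrt (abs_nonneg _)
  have hmem : MemLp (fun y => Real.sqrt |g y|) 2 volume := by
    rw [memLp_two_iff_integrable_sq hm, hsq]
    exact hg.abs
  have h := LGFS.integral_abs_le_sqrt_of_memLp hmem
  simp only [abs_of_nonneg (Real.sqrt_nonneg _)] at h
  rwa [hsq] at h

/-- **Continuity of the cone-smeared position entropy in total variation (B′, position half of the upper bound).**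
For measurable `0 ≤ n₁` with `n₁ ≤ K′` a.e., measurable `0 ≤ n₂ ≤ K′` (`K′ ≥ 1`), both integrable with `∫ |n₁ − n₂| ≤ κ`,
and every centre `x` and radius `r > 0`:
`|∫ b_r(y,x) (n₁ log n₁ − n₂ log n₂)(y) dy| ≤ (3/(π r³)) ((1 + log K′) κ + 2 √κ)`. -/
theorem em_cone_entropy_sub_le : ∀ {n₁ n₂ : T3 → ℝ} {K κ r : ℝ}, 1 ≤ K → 0 < r → Measurable n₁ → (∀ y, 0 ≤ n₁ y) → (∀ᵐ y : T3, n₁ y ≤ K) → Measurable n₂ → (∀ y, 0 ≤ n₂ y) → (∀ y, n₂ y ≤ K) → Integrable n₁ → Integrable n₂ → ∫ y, |n₁ y - n₂ y| ≤ κ → ∀ x : T3, |∫ y, cone r y x * (n₁ y * Real.log (n₁ y) - n₂ y * Real.log (n₂ y))| ≤ 3 / (Real.pi * r ^ 3) * ((1 + Real.log K) * κ + 2 * Real.sqrt κ) := by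
  intro n₁ n₂ K κ r hK hr h1m h10 h1K h2m h20 h2K h1i h2i hL1 x
  set C : ℝ := 3 / (Real.pi * r ^ 3) with hC
  have hC0 : 0 ≤ C := by positivity
  have hlogK : 0 ≤ Real.log K := Real.log_nonneg hK
  set D : T3 → ℝ := fun y => n₁ y * Real.log (n₁ y) - n₂ y * Real.log (n₂ y) with hD
  set E : T3 → ℝ := fun y => (1 + Real.log K) * |n₁ y - n₂ y| + 2 * Real.sqrt |n₁ y - n₂ y| with hE
  have hdi : Integrable fun y => n₁ y - n₂ y := h1i.sub h2i
  have hκ : 0 ≤ κ := (integral_nonneg fun y => abs_nonneg _).trans hL1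
  -- measurability / integrability
  have hDm : Measurable D :=
    (h1m.mul (Real.measurable_log.comp h1m)).sub (h2m.mul (Real.measurable_log.comp h2m))
  have hsqi : Integrable fun y => Real.sqrt |n₁ y - n₂ y| := by
    refine (hdi.abs.add (integrable_const (1 : ℝ))).mono'
      (Real.continuous_sqrt.comp_aestronglyMeasurable (hdi.aestronglyMeasurable.norm.congr
        (ae_of_all _ fun y => Real.norm_eq_abs _))) (ae_of_all _ fun y => ?_)
    rw [Real.norm_eq_abs, abs_of_nonneg (Real.sqrt_nonneg _)]
    have ha : 0 ≤ |n₁ y - n₂ y| := abs_nonneg _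
    show Real.sqrt |n₁ y - n₂ y| ≤ |n₁ y - n₂ y| + 1
    exact Real.sqrt_le_iff.2 ⟨by positivity, by nlinarith⟩
  have hEi : Integrable E := (hdi.abs.const_mul _).add (hsqi.const_mul _)
  -- the a.e. pointwise modulus
  have hDE : ∀ᵐ y : T3, |D y| ≤ E y := by
    filter_upwards [h1K] with y hy
    exact em_abs_mul_log_sub_mul_log_le (h20 y) (h10 y) (h2K y) hy hK
  have hDi : Integrable D :=
    hEi.mono' hDm.aestronglyMeasurable (hDE.mono fun y hy => by rw [Real.norm_eq_abs]; exact hy)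
  -- cone bounds
  have hc0 : ∀ y, 0 ≤ cone r y x := fun y => cone_nonneg hr y x
  have hcC : ∀ y, cone r y x ≤ C := fun y => contactB_cone_le_const hr y x
  have hcm : Measurable fun y => cone r y x := (contactB_continuous_cone_left r x).measurable
  have hcDi : Integrable fun y => cone r y x * D y :=
    hDi.bdd_mul hcm.aestronglyMeasurable
      (ae_of_all _ fun y => by rw [Real.norm_eq_abs, abs_of_nonneg (hc0 y)]; exact hcC y)
  -- the integral of the majorant
  have hI1 : Integrable (fun y => (1 + Real.log K) * |n₁ y - n₂ y|) := hdi.abs.const_mul _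
  have hI2 : Integrable (fun y => 2 * Real.sqrt |n₁ y - n₂ y|) := hsqi.const_mul _
  have hIE : ∫ y, E y ≤ (1 + Real.log K) * κ + 2 * Real.sqrt κ := by
    have e1 : ∫ y, E y = (1 + Real.log K) * (∫ y, |n₁ y - n₂ y|) + 2 * (∫ y, Real.sqrt |n₁ y - n₂ y|) := by
      rw [← integral_const_mul, ← integral_const_mul, ← integral_add hI1 hI2]
    rw [e1]
    have h1K : (0 : ℝ) ≤ 1 + Real.log K := by positivity
    have hsq : ∫ y, Real.sqrt |n₁ y - n₂ y| ≤ Real.sqrt κ :=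
      (em_integral_sqrt_abs_le hdi).trans (Real.sqrt_le_sqrt hL1)
    nlinarith [mul_le_mul_of_nonneg_left hL1 h1K]
  -- the chain
  calc |∫ y, cone r y x * D y| ≤ ∫ y, |cone r y x * D y| := abs_integral_le_integral_abs
    _ ≤ ∫ y, C * E y := by
        refine integral_mono_ae hcDi.abs (hEi.const_mul C) ?_
        filter_upwards [hDE] with y hy
        rw [abs_mul, abs_of_nonneg (hc0 y)]
        exact mul_le_mul (hcC y) hy (abs_nonneg _) hC0
    _ = C * ∫ y, E y := integral_const_mul C E
    _ ≤ C * ((1 + Real.log K) * κ + 2 * Real.sqrt κ) := mul_le_mul_of_nonneg_left hIE hC0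

end Summit.AtomisticToContinuum.HydrodynamicLimit.Theorems.LocalSecondLawInitialMatching

end
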